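import Literature.Analysis.FluidPDE.ESSLocalHolderBlowupTop
import Literature.Analysis.FluidPDE.Seregin2020BlowupLimit
import HarnessLib

/-!
# Weak vanishing of a blow-up limit at the final time, from a uniform pairing modulus, an apex
# trace and the vanishing of its critical rescalings (the top-vanishing step of the
# ESS / Wang–Zhang blow-up argument, generic form)

Analysis/FluidPDE proofs-only file (theorems only: no definition, no named fact; nothing accepted
is restated or changed). The step "`v(x, 0) = 0`" of the blow-up argument — Escauriaza–Seregin–
Šverák, Russ. Math. Surveys 58 (2003), §3 (3.13); G. Seregin, *Lecture notes* (2014), §6.6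
(6.6.3); in the Besov setting W. Wang, Z. Zhang, Sci. China Math. 60 (2017) = arXiv:1510.02589,
§4 **Step 2** ("Prove `v(x,0) = 0`": `|∫_{B_a} v(x,0)φ| ≤ C ∫_{B_a}|v(x,0) - u^k(x,0)| +
|∫_{B_a} u^k(x,0) φ|`, the last term being the pairing of the rescaled final datum
`r_k u(r_k ·, 0)`, small because `u(0) ∈ VMO^{-1}`; for all components in `Ḃ^{-1+3/p}_{p,q}`,
`q < ∞`, because critical rescalings of such distributions tend to `0` in `𝓢'`) — is proved in
the tree for the `L_{3,∞}` class as `blowup_top_vanishing` (`ESSLocalHolderBlowupTop.lean`). Its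
proof uses the `L_{3,∞}` hypothesis at three points only: the uniform modulus of continuity of the
rescaled pairings (`exists_uniform_pairing_modulus_zoom`), the existence of the apex trace `v̂`
(`exists_apex_trace`), and the vanishing of the apex values
`μ_j⁻² ∫ ⟪v̂, φ(μ_j⁻¹(· - x₀))⟫ → 0` (`tendsto_apex_pairing_zero`, from `v̂ ∈ L³`). This file
re-runs the proof verbatim with these three facts as hypotheses (`hmodulus`, `htrace`, `hvan`),
together with the measurability of `v` near `z₀` and the bound `C(r; z₀) ≤ M` (for the
finiteness of `∫_{Q(ρ)} |u^{μ}|³`), which is the form consumed by the Besov blow-up argument: there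
the apex trace is the final value `u(T) ∈ L²` of the Leray–Hopf solution
(`IsLerayHopfOn.exists_isDistributionOf_final_memHomBesov`) and the apex values vanish along the
dyadic scales by `IsDistributionOf.tendsto_integral_smul_rescaleData_atBot`.

## Contents

* `exists_uniform_pairing_modulus_of_bounds` — the hypothesis `hmodulus` for a pair solving the
  system in `Q(z₀, 1/2)` with `A(r; z₀) ≤ K`, `D(r; z₀) ≤ K` for `0 < r ≤ 1/2` (the tree's
  `NSCylinder.exists_fullMeasure_pairing_modulus` fed with the rescaled bounds);
* `top_vanishing_of_modulus_of_apexTrace` — for every test field `φ` and `ε > 0` there is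
  `s₀ < 0` with `|∫ ⟪w(s), φ⟫| ≤ ε` for a.e. `s ∈ ]s₀, 0[`, for the strong `L³(Q(a))` limit `w`
  of the rescaled velocities `u^{μ_j}`, `μ_j = 2^{-(δ(j)+2)}`.

## References

* L. Escauriaza, G. Seregin, V. Šverák, Russ. Math. Surveys 58 (2003), §3 (3.13).
  [EscauriazaSereginSverak2003]
* G. Seregin, *Lecture notes on regularity theory for the Navier–Stokes equations* (2014), §6.6
  (6.6.2)–(6.6.3). [Seregin2014]
* W. Wang, Z. Zhang, Sci. China Math. 60 (2017) 637–650 = arXiv:1510.02589, §4 Step 2.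
  [WangZhang2016]
-/

noncomputable section

open MeasureTheory Set Function Filter Topology TopologicalSpace Metric
open scoped NNReal ENNReal InnerProductSpace RealInnerProductSpace

namespace Literature.Analysis.FluidPDE

section Top

variable {v : ℝ → EuclideanSpace ℝ (Fin 3) → EuclideanSpace ℝ (Fin 3)}

/-- **The blow-up limit vanishes at the final time, weakly — generic form** (Seregin 2014, §6.6,
(6.6.3); ESS 2003, §3 (3.13); Wang–Zhang 2017, §4 Step 2). Let `v` be a velocity field,
measurable on `Q(z₀, 1/2)` with `C(r; z₀) ≤ M` for `0 < r ≤ 1/2`; suppose (`hmodulus`) the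
pairings `s ↦ ∫ ⟪u^μ(s), φ⟫` of the rescaled fields `u^μ = μ v(t₀ + μ²·, x₀ + μ·)` with a test
field supported in `B(0, ρ)` admit a modulus `A|s-s'| + B|s-s'|^{1/3}` on a full-measure subset
of `]-ρ², 0[`, uniformly in `0 < μ ≤ 1/(2ρ)`; (`htrace`) `v` has an apex trace `v̂` at `z₀` on
the test fields of `B(x₀, 1/2)`; and (`hvan`) the apex values along the dyadic scales vanish,
`4ⁿ ∫ ⟪v̂, φ(2ⁿ(· - x₀))⟫ → 0`. Let `w` be a strong `L³(Q(a))` limit, for every `a > 0`, of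
`u^{μ_j}`, `μ_j = 2^{-(δ(j)+2)}`, `δ(j) ≥ j`. Then for every test field `φ` and `ε > 0` there is
`s₀ < 0` with `|∫ ⟪w(s), φ⟫| ≤ ε` for a.e. `s ∈ ]s₀, 0[`. The proof is that of
`blowup_top_vanishing`, verbatim. [cite: Seregin2014, §6.6 (6.6.3)] [cite: EscauriazaSereginSverak2003, §3 (3.13)] [cite: WangZhang2016, §4 Step 2] -/
theorem top_vanishing_of_modulus_of_apexTrace
    {z₀ : ℝ × EuclideanSpace ℝ (Fin 3)}
    (hvm : AEStronglyMeasurable (uncurry v) (volume.restrict (parabolicCylinder (1 / 2) z₀)))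
    {M : ℝ≥0} (hM : ∀ r ∈ Ioc (0 : ℝ) (1 / 2), cknC r z₀ v ≤ M)
    (hmodulus : ∀ {φ : EuclideanSpace ℝ (Fin 3) → EuclideanSpace ℝ (Fin 3)}, ContDiff ℝ (⊤ : ℕ∞) φ →
      HasCompactSupport φ → ∀ {ρ : ℝ}, 1 ≤ ρ → tsupport φ ⊆ ball (0 : EuclideanSpace ℝ (Fin 3)) ρ →
      ∃ A B : ℝ, 0 ≤ A ∧ 0 ≤ B ∧ ∀ μ : ℝ, 0 < μ → ρ * μ ≤ 1 / 2 →
        ∃ S : Set ℝ, (∀ᵐ s ∂(volume.restrict (Ioo (-ρ ^ 2) 0)), s ∈ S) ∧ ∀ s ∈ S, ∀ s' ∈ S,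
          |(∫ y, ⟪(μ • stPull (μ ^ 2) μ z₀.1 z₀.2 v) s y, φ y⟫) -
              ∫ y, ⟪(μ • stPull (μ ^ 2) μ z₀.1 z₀.2 v) s' y, φ y⟫| ≤
            A * |s - s'| + B * |s - s'| ^ (1 / 3 : ℝ))
    {vh : EuclideanSpace ℝ (Fin 3) → EuclideanSpace ℝ (Fin 3)}
    (htrace : ∀ θ : EuclideanSpace ℝ (Fin 3) → EuclideanSpace ℝ (Fin 3),
      FunctionSpaces.IsTestFunctionOn
        (⟨ball z₀.2 (1 / 2), isOpen_ball⟩ : Opens (EuclideanSpace ℝ (Fin 3))) θ →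
      ∀ ε : ℝ, 0 < ε → ∃ τ : ℝ, 0 < τ ∧
        ∀ᵐ t ∂(volume.restrict (Ioo (z₀.1 - τ) z₀.1)),
          |(∫ x in ball z₀.2 (1 / 2), ⟪v t x, θ x⟫) - ∫ x, ⟪vh x, θ x⟫| ≤ ε)
    (hvan : ∀ {φ : EuclideanSpace ℝ (Fin 3) → EuclideanSpace ℝ (Fin 3)}, ContDiff ℝ (⊤ : ℕ∞) φ →
      HasCompactSupport φ →
      Tendsto (fun n : ℕ => (((1 / 2 : ℝ) ^ n) ^ 2)⁻¹ *
        ∫ x, ⟪vh x, φ (((1 / 2 : ℝ) ^ n)⁻¹ • (x - z₀.2))⟫) atTop (𝓝 0))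
    {δ : ℕ → ℕ} (hδge : ∀ k, k ≤ δ k)
    {w : ℝ → EuclideanSpace ℝ (Fin 3) → EuclideanSpace ℝ (Fin 3)}
    (hwm : ∀ a : ℝ, 0 < a → MemLp (uncurry w) 3
      (volume.restrict (parabolicCylinder a (0 : ℝ × EuclideanSpace ℝ (Fin 3)))))
    (hconv : ∀ a : ℝ, 0 < a → Tendsto (fun j => eLpNorm
        (uncurry (((1 / 2 : ℝ) ^ (δ j + 2)) •
            stPull (((1 / 2 : ℝ) ^ (δ j + 2)) ^ 2) ((1 / 2 : ℝ) ^ (δ j + 2)) z₀.1 z₀.2 v) -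
          uncurry w) 3
        (volume.restrict (parabolicCylinder a (0 : ℝ × EuclideanSpace ℝ (Fin 3)))))
      atTop (𝓝 0))
    {φ : EuclideanSpace ℝ (Fin 3) → EuclideanSpace ℝ (Fin 3)} (hφ : ContDiff ℝ (⊤ : ℕ∞) φ)
    (hφc : HasCompactSupport φ) {ε : ℝ} (hε : 0 < ε) :
    ∃ s₀ : ℝ, s₀ < 0 ∧ ∀ᵐ s ∂(volume.restrict (Ioo s₀ 0)), |∫ y, ⟪w s y, φ y⟫| ≤ ε := by
  classical
  -- ## the radius `ρ ≥ 1` containing the support of `φ`, and the bounds of `φ`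
  obtain ⟨R, hR⟩ := hφc.isCompact.isBounded.subset_closedBall (0 : EuclideanSpace ℝ (Fin 3))
  set ρ : ℝ := max 1 (R + 1) with hρdef
  have hρ1 : 1 ≤ ρ := le_max_left _ _
  have hρ : 0 < ρ := one_pos.trans_le hρ1
  have hφρ : tsupport φ ⊆ ball (0 : EuclideanSpace ℝ (Fin 3)) ρ := fun x hx =>
    (closedBall_subset_ball (by rw [hρdef]; exact lt_of_lt_of_le (by linarith) (le_max_right _ _))) (hR hx)
  have hηt : FunctionSpaces.IsTestFunctionOn (⟨ball 0 ρ, isOpen_ball⟩ : Opens (EuclideanSpace ℝ (Fin 3))) φ :=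
    ⟨hφ, hφc, hφρ⟩
  obtain ⟨K₀, K₁, K₂, hK₀, -, -⟩ := exists_bounds_of_isTestFunctionOn hηt
  have hK₀0 : 0 ≤ K₀ := (norm_nonneg _).trans (hK₀ 0)
  obtain ⟨A, B, hA, hB, hmod⟩ := hmodulus hφ hφc hρ1 hφρ
  set ω : ℝ → ℝ := fun d => A * d + B * d ^ (1 / 3 : ℝ) with hω
  have hωmono : ∀ x y : ℝ, 0 ≤ x → x ≤ y → ω x ≤ ω y := by
    intro x y hx hxy
    simp only [hω]
    exact add_le_add (mul_le_mul_of_nonneg_left hxy hA)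
      (mul_le_mul_of_nonneg_left (Real.rpow_le_rpow hx hxy (by norm_num)) hB)
  -- ## the scales, from `j₀` on
  set lam : ℕ → ℝ := fun n => (1 / 2 : ℝ) ^ (n + 2) with hlam
  have hlam_pos : ∀ n, 0 < lam n := fun n => by positivity
  obtain ⟨j₀, hj₀⟩ := eventually_scale_mul_le_half hδge hρ
  set μ : ℕ → ℝ := fun j => lam (δ (j + j₀)) with hμdef
  have hμpos : ∀ j, 0 < μ j := fun j => hlam_pos _
  have hρμ : ∀ j, ρ * μ j ≤ 1 / 2 := fun j => hj₀ _ (Nat.le_add_left _ _)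
  have hμ0 : Tendsto μ atTop (𝓝 0) := by
    have h1 : Tendsto (fun j : ℕ => (1 / 2 : ℝ) ^ (j + 2)) atTop (𝓝 0) :=
      (tendsto_pow_atTop_nhds_zero_of_lt_one (by norm_num) (by norm_num)).comp (tendsto_add_atTop_nat 2)
    refine tendsto_of_tendsto_of_tendsto_of_le_of_le tendsto_const_nhds h1 (fun j => (hμpos j).le) fun j => ?_
    show (1 / 2 : ℝ) ^ (δ (j + j₀) + 2) ≤ (1 / 2) ^ (j + 2)
    exact pow_le_pow_of_le_one (by norm_num) (by norm_num) (by have := hδge (j + j₀); omega)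
  set U : ℕ → ℝ → EuclideanSpace ℝ (Fin 3) → EuclideanSpace ℝ (Fin 3) :=
    fun j => (μ j) • stPull ((μ j) ^ 2) (μ j) z₀.1 z₀.2 v with hU
  -- ## the transported test fields and the apex trace
  set θ : ℕ → EuclideanSpace ℝ (Fin 3) → EuclideanSpace ℝ (Fin 3) :=
    fun j x => φ ((μ j)⁻¹ • (x - z₀.2)) with hθ
  have hθt : ∀ j, FunctionSpaces.IsTestFunctionOn
      (⟨ball z₀.2 (1 / 2), isOpen_ball⟩ : Opens (EuclideanSpace ℝ (Fin 3))) (θ j) :=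
    fun j => isTestFunctionOn_transport hφ hφc hφρ (hμpos j) (hρμ j) z₀.2
  have htr : ∀ j : ℕ, ∀ ε : ℝ, 0 < ε → ∃ τ : ℝ, 0 < τ ∧
      ∀ᵐ t ∂(volume.restrict (Ioo (z₀.1 - τ) z₀.1)),
        |(∫ x in ball z₀.2 (1 / 2), ⟪v t x, θ j x⟫) - ∫ x, ⟪vh x, θ j x⟫| ≤ ε :=
    fun j => htrace (θ j) (hθt j)
  set ℓ : ℕ → ℝ := fun j => (μ j ^ 2)⁻¹ * ∫ x, ⟪vh x, θ j x⟫ with hℓ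
  have hℓ0 : Tendsto ℓ atTop (𝓝 0) := by
    have hn : Tendsto (fun j : ℕ => δ (j + j₀) + 2) atTop atTop := by
      refine tendsto_atTop_mono (fun j => ?_) (tendsto_add_atTop_nat 2)
      have := hδge (j + j₀); omega
    exact (hvan hφ hφc).comp hn
  -- the pairings of the rescaled velocities
  set pair : ℕ → ℝ → ℝ := fun j s => ∫ y, ⟪U j s y, φ y⟫ with hpair
  have hpair_eq : ∀ j s, pair j s = (μ j ^ 2)⁻¹ * ∫ x in ball z₀.2 (1 / 2),
      ⟪v (z₀.1 + μ j ^ 2 * s) x, θ j x⟫ := by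
    intro j s
    rw [hpair, hU]
    dsimp only
    rw [integral_inner_zoom_eq v φ (hμpos j) z₀ s,
      integral_inner_eq_setIntegral_of_tsupport (hθt j).tsupport_subset]
    rfl
  -- ## KEY: `|pair_j(s) - ℓ_j| ≤ ω(|s|)` a.e. on `]-ρ², 0[`
  have hkey : ∀ j, ∀ᵐ s ∂(volume.restrict (Ioo (-ρ ^ 2) 0)), |pair j s - ℓ j| ≤ ω (|s|) := by
    intro j
    obtain ⟨S, hS, hSmod⟩ := hmod (μ j) (hμpos j) (hρμ j)
    filter_upwards [hS, ae_restrict_mem measurableSet_Ioo] with s hsS hsI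
    refine le_of_forall_pos_le_add fun ε' hε' => ?_
    -- the apex trace for `θ_j`, at accuracy `μ² ε'`
    obtain ⟨τ, hτ, hτtr⟩ := htr j (μ j ^ 2 * ε') (by have := hμpos j; positivity)
    -- transported to the `s`-variable: a.e. `σ ∈ ]-τ/μ², 0[`
    have htr' : ∀ᵐ σ ∂(volume.restrict (Ioo (-τ / μ j ^ 2) 0)), |pair j σ - ℓ j| ≤ ε' := by
      have hβ : 0 < μ j ^ 2 := pow_pos (hμpos j) 2
      have h0 : ∀ᵐ t ∂(volume.restrict (Ioo (z₀.1 + μ j ^ 2 * (-τ / μ j ^ 2)) (z₀.1 + μ j ^ 2 * 0))),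
          |(∫ x in ball z₀.2 (1 / 2), ⟪v t x, θ j x⟫) - ∫ x, ⟪vh x, θ j x⟫| ≤ μ j ^ 2 * ε' := by
        have e : Ioo (z₀.1 + μ j ^ 2 * (-τ / μ j ^ 2)) (z₀.1 + μ j ^ 2 * 0) = Ioo (z₀.1 - τ) z₀.1 := by
          rw [mul_div_cancel₀ _ hβ.ne', mul_zero, add_zero, ← sub_eq_add_neg]
        rw [e]; exact hτtr
      have h1 := ae_restrict_Ioo_comp_time_affine hβ z₀.1 (-τ / μ j ^ 2) 0 h0
      filter_upwards [h1] with σ hσ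
      rw [hpair_eq, hℓ]
      dsimp only
      rw [← mul_sub, abs_mul, abs_of_pos (inv_pos.2 hβ)]
      rw [inv_mul_le_iff₀ hβ]
      exact hσ
    -- a good `σ ∈ ]s, 0[`
    have hsneg : s < 0 := hsI.2
    set s₁ : ℝ := max s (-τ / μ j ^ 2) with hs₁
    have hs₁0 : s₁ < 0 := max_lt hsneg (by
      have := hμpos j; have : 0 < τ / μ j ^ 2 := by positivity
      rw [neg_div]; linarith)
    have hGσ : ∀ᵐ σ ∂(volume.restrict (Ioo s₁ 0)), σ ∈ S ∩ {σ | |pair j σ - ℓ j| ≤ ε'} := by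
      have h1 : Ioo s₁ 0 ⊆ Ioo (-ρ ^ 2) 0 := Ioo_subset_Ioo ((hsI.1.le).trans (le_max_left _ _)) le_rfl
      have h2 : Ioo s₁ 0 ⊆ Ioo (-τ / μ j ^ 2) 0 := Ioo_subset_Ioo (le_max_right _ _) le_rfl
      filter_upwards [ae_restrict_of_ae_restrict_of_subset h1 hS,
        ae_restrict_of_ae_restrict_of_subset h2 htr'] with σ h3 h4
      exact ⟨h3, h4⟩
    obtain ⟨σ, ⟨hσS, hσtr⟩, hσ1, -, hσ0⟩ := exists_mem_fullMeasure_near_top hs₁0 hGσ one_pos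
    have hsσ : s < σ := (le_max_left _ _).trans_lt hσ1
    -- the estimate
    have h5 := hSmod s hsS σ hσS
    have hd : |s - σ| = σ - s := by rw [abs_sub_comm]; exact abs_of_pos (by linarith)
    rw [hd] at h5
    have h6 : ω (σ - s) ≤ ω (|s|) := by
      refine hωmono _ _ (by linarith) ?_
      rw [abs_of_neg hsneg]; linarith
    calc |pair j s - ℓ j| ≤ |pair j s - pair j σ| + |pair j σ - ℓ j| := abs_sub_le _ _ _
      _ ≤ ω (σ - s) + ε' := add_le_add h5 hσtr
      _ ≤ ω (|s|) + ε' := add_le_add h6 le_rfl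
  -- ## the pairings converge to the pairing of `w`, a.e. along a subsequence
  set I : Set ℝ := Ioo (-ρ ^ 2) 0 with hI
  set Bρ : Set (EuclideanSpace ℝ (Fin 3)) := ball 0 ρ with hBρ
  have hQ : parabolicCylinder ρ (0 : ℝ × EuclideanSpace ℝ (Fin 3)) = I ×ˢ Bρ := by
    rw [parabolicCylinder, hI, hBρ]; simp
  set μQ : Measure (ℝ × EuclideanSpace ℝ (Fin 3)) := volume.restrict (I ×ˢ Bρ) with hμQ
  have hμQprod : μQ = (volume.restrict I).prod (volume.restrict Bρ) := by
    rw [hμQ, Measure.prod_restrict, ← Measure.volume_eq_prod]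
  haveI : IsFiniteMeasure μQ := by
    refine ⟨?_⟩
    rw [hμQ, Measure.restrict_apply_univ, ← hQ]
    exact lt_of_le_of_lt (measure_mono (parabolicCylinder_subset_Icc_prod_closedBall _ _))
      (isCompact_Icc_prod_closedBall _ _).measure_lt_top
  set pw : ℝ → ℝ := fun s => ∫ y, ⟪w s y, φ y⟫ with hpw
  have hwm' : MemLp (uncurry w) 3 μQ := by rw [hμQ, ← hQ]; exact hwm ρ hρ
  have hUm' : ∀ j, MemLp (uncurry (U j)) 3 μQ := by
    intro j
    refine ⟨?_, ?_⟩
    · rw [hμQ, ← hQ]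
      exact aestronglyMeasurable_uncurry_zoom_of hvm (hμpos j) hρ (hρμ j)
    · -- `∫_{Q(ρ)} |U_j|³ = ρ² C(ρ μ_j) < ∞`
      rw [eLpNorm_three_eq_lintegral_cube_rpow]
      refine ENNReal.rpow_lt_top_of_nonneg (by norm_num) ?_
      rw [hμQ, ← hQ]
      have e : ∫⁻ z, ‖uncurry (U j) z‖ₑ ^ (3 : ℕ) ∂volume.restrict (parabolicCylinder ρ (0 : ℝ × EuclideanSpace ℝ (Fin 3))) =
          ∫⁻ z in parabolicCylinder ρ ((0 : ℝ), (0 : EuclideanSpace ℝ (Fin 3))),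
            ‖((μ j) • stPull ((μ j) ^ 2) (μ j) z₀.1 z₀.2 v) z.1 z.2‖ₑ ^ (3 : ℕ) := rfl
      rw [e, lintegral_cube_zoom_radius (hμpos j) hρ z₀ v]
      exact ENNReal.mul_ne_top (ENNReal.pow_ne_top ENNReal.ofReal_ne_top)
        (ne_top_of_le_ne_top ENNReal.coe_ne_top (hM _ ⟨by positivity, hρμ j⟩))
  have hconv' : Tendsto (fun j => eLpNorm (uncurry (U j) - uncurry w) 3 μQ) atTop (𝓝 0) := by
    rw [hμQ, ← hQ]
    exact (tendsto_add_atTop_iff_nat (f := fun j => eLpNorm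
      (uncurry ((lam (δ j)) • stPull ((lam (δ j)) ^ 2) (lam (δ j)) z₀.1 z₀.2 v) - uncurry w) 3
        (volume.restrict (parabolicCylinder ρ (0 : ℝ × EuclideanSpace ℝ (Fin 3))))) j₀).2 (hconv ρ hρ)
  -- slice integrability, a.e. in `s`
  have hint_w : ∀ᵐ s ∂(volume.restrict I), Integrable (fun y => w s y) (volume.restrict Bρ) := by
    have h1 : Integrable (uncurry w) μQ := hwm'.integrable (by norm_num)
    rw [hμQprod] at h1
    filter_upwards [h1.prod_right_ae] with s hs
    exact hs
  have hint_U : ∀ j, ∀ᵐ s ∂(volume.restrict I), Integrable (fun y => U j s y) (volume.restrict Bρ) := by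
    intro j
    have h1 : Integrable (uncurry (U j)) μQ := (hUm' j).integrable (by norm_num)
    rw [hμQprod] at h1
    filter_upwards [h1.prod_right_ae] with s hs
    exact hs
  -- ## the `L¹(]-ρ²,0[)` distance of the pairings is controlled by `‖U_j - w‖_{L³(Q(ρ))}`
  have hφm : AEStronglyMeasurable φ (volume.restrict Bρ) := hφ.continuous.aestronglyMeasurable
  have hinner_int : ∀ {f : EuclideanSpace ℝ (Fin 3) → EuclideanSpace ℝ (Fin 3)},
      Integrable f (volume.restrict Bρ) → Integrable (fun y => ⟪f y, φ y⟫) (volume.restrict Bρ) := by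
    intro f hf
    refine Integrable.mono' (hf.norm.mul_const K₀) (hf.1.inner hφm) (Eventually.of_forall fun y => ?_)
    calc ‖⟪f y, φ y⟫‖ ≤ ‖f y‖ * ‖φ y‖ := norm_inner_le_norm _ _
      _ ≤ ‖f y‖ * K₀ := mul_le_mul_of_nonneg_left (hK₀ _) (norm_nonneg _)
  -- the difference of the pairings as one integral, a.e. in `s`
  have hdiff : ∀ j, ∀ᵐ s ∂(volume.restrict I),
      pair j s - pw s = ∫ y in Bρ, ⟪U j s y - w s y, φ y⟫ := by
    intro j
    filter_upwards [hint_w, hint_U j] with s hws hUs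
    rw [hpair, hpw]
    dsimp only
    rw [integral_inner_eq_setIntegral_of_tsupport hφρ, integral_inner_eq_setIntegral_of_tsupport hφρ,
      ← integral_sub (hinner_int hUs) (hinner_int hws)]
    refine integral_congr_ae (Eventually.of_forall fun y => ?_)
    show ⟪U j s y, φ y⟫ - ⟪w s y, φ y⟫ = ⟪U j s y - w s y, φ y⟫
    rw [inner_sub_left]
  -- integrability of the difference functions on the product and in `s`
  have hF_int : ∀ j, Integrable (fun z : ℝ × EuclideanSpace ℝ (Fin 3) => ⟪U j z.1 z.2 - w z.1 z.2, φ z.2⟫)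
      ((volume.restrict I).prod (volume.restrict Bρ)) := by
    intro j
    have hD : Integrable (uncurry (U j) - uncurry w) ((volume.restrict I).prod (volume.restrict Bρ)) := by
      rw [← hμQprod]; exact ((hUm' j).sub hwm').integrable (by norm_num)
    have hφm2 : AEStronglyMeasurable (fun z : ℝ × EuclideanSpace ℝ (Fin 3) => φ z.2)
        ((volume.restrict I).prod (volume.restrict Bρ)) :=
      (hφ.continuous.comp continuous_snd).aestronglyMeasurable
    refine Integrable.mono' (hD.norm.mul_const K₀) (hD.1.inner hφm2) (Eventually.of_forall fun z => ?_)
    calc ‖⟪U j z.1 z.2 - w z.1 z.2, φ z.2⟫‖ ≤ ‖U j z.1 z.2 - w z.1 z.2‖ * ‖φ z.2‖ := norm_inner_le_norm _ _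
      _ ≤ ‖(uncurry (U j) - uncurry w) z‖ * K₀ := mul_le_mul_of_nonneg_left (hK₀ _) (norm_nonneg _)
  have hdiff_int : ∀ j, Integrable (fun s => pair j s - pw s) (volume.restrict I) := by
    intro j
    have h1 := (hF_int j).integral_prod_left
    exact h1.congr ((hdiff j).mono fun s hs => hs.symm)
  have hpairL1 : ∀ j, eLpNorm (fun s => pair j s - pw s) 1 (volume.restrict I) ≤
      ENNReal.ofReal K₀ * (eLpNorm (uncurry (U j) - uncurry w) 3 μQ * μQ univ ^ (2 / 3 : ℝ)) := by
    intro j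
    -- pointwise in `s`
    have hpt : ∀ᵐ s ∂(volume.restrict I), ‖pair j s - pw s‖ₑ ≤
        ENNReal.ofReal K₀ * ∫⁻ y in Bρ, ‖U j s y - w s y‖ₑ := by
      filter_upwards [hdiff j] with s hs
      rw [hs]
      refine (enorm_integral_le_lintegral_enorm _).trans ?_
      rw [← lintegral_const_mul' _ _ ENNReal.ofReal_ne_top]
      refine lintegral_mono fun y => ?_
      rw [← ofReal_norm, ← ofReal_norm, ← ENNReal.ofReal_mul hK₀0]
      refine ENNReal.ofReal_le_ofReal ?_
      calc ‖⟪U j s y - w s y, φ y⟫‖ ≤ ‖U j s y - w s y‖ * ‖φ y‖ := norm_inner_le_norm _ _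
        _ ≤ ‖U j s y - w s y‖ * K₀ := mul_le_mul_of_nonneg_left (hK₀ _) (norm_nonneg _)
        _ = K₀ * ‖U j s y - w s y‖ := mul_comm _ _
    -- Tonelli
    have hDm : AEMeasurable (fun z : ℝ × EuclideanSpace ℝ (Fin 3) => ‖(uncurry (U j) - uncurry w) z‖ₑ)
        ((volume.restrict I).prod (volume.restrict Bρ)) := by
      rw [← hμQprod]; exact ((hUm' j).sub hwm').1.enorm
    have hT : ∫⁻ s in I, ∫⁻ y in Bρ, ‖U j s y - w s y‖ₑ = ∫⁻ z, ‖(uncurry (U j) - uncurry w) z‖ₑ ∂μQ := by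
      rw [hμQprod, lintegral_prod _ hDm]
      rfl
    rw [eLpNorm_one_eq_lintegral_enorm]
    calc ∫⁻ s, ‖pair j s - pw s‖ₑ ∂volume.restrict I
        ≤ ∫⁻ s in I, ENNReal.ofReal K₀ * ∫⁻ y in Bρ, ‖U j s y - w s y‖ₑ := lintegral_mono_ae hpt
      _ = ENNReal.ofReal K₀ * ∫⁻ z, ‖(uncurry (U j) - uncurry w) z‖ₑ ∂μQ := by
          rw [lintegral_const_mul' _ _ ENNReal.ofReal_ne_top, hT]
      _ = ENNReal.ofReal K₀ * eLpNorm (uncurry (U j) - uncurry w) 1 μQ := by rw [eLpNorm_one_eq_lintegral_enorm]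
      _ ≤ ENNReal.ofReal K₀ * (eLpNorm (uncurry (U j) - uncurry w) 3 μQ * μQ univ ^ (2 / 3 : ℝ)) := by
          refine mul_le_mul' le_rfl ?_
          have := eLpNorm_le_eLpNorm_mul_rpow_measure_univ (p := 1) (q := 3) (by norm_num)
            ((hUm' j).sub hwm').1
          rw [ENNReal.toReal_one, ENNReal.toReal_ofNat, show (1 / 1 - 1 / 3 : ℝ) = 2 / 3 by norm_num] at this
          exact this
  have hL1 : Tendsto (fun j => eLpNorm (fun s => pair j s - pw s) 1 (volume.restrict I)) atTop (𝓝 0) := by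
    have hfin : μQ univ ^ (2 / 3 : ℝ) ≠ ∞ := ENNReal.rpow_ne_top_of_nonneg (by norm_num) (measure_ne_top _ _)
    have h1 : Tendsto (fun j => ENNReal.ofReal K₀ * (eLpNorm (uncurry (U j) - uncurry w) 3 μQ * μQ univ ^ (2 / 3 : ℝ)))
        atTop (𝓝 0) := by
      have h2 := ENNReal.Tendsto.mul_const hconv' (Or.inr hfin)
      rw [zero_mul] at h2
      have h3 := ENNReal.Tendsto.const_mul (a := ENNReal.ofReal K₀) h2 (Or.inr ENNReal.ofReal_ne_top)
      rwa [mul_zero] at h3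
    exact tendsto_of_tendsto_of_tendsto_of_le_of_le tendsto_const_nhds h1 (fun j => bot_le) hpairL1
  -- a.e. convergence along a subsequence
  have hTIM : TendstoInMeasure (volume.restrict I) (fun j s => pair j s - pw s) atTop (fun _ => (0 : ℝ)) := by
    refine tendstoInMeasure_of_tendsto_eLpNorm one_ne_zero (fun j => (hdiff_int j).1) aestronglyMeasurable_const ?_
    refine (tendsto_congr fun j => ?_).1 hL1
    congr 1
    funext s
    simp
  obtain ⟨ns, hns, hae⟩ := hTIM.exists_seq_tendsto_ae
  -- ## `|pw(s)| ≤ ω(|s|)` a.e.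
  have hpw_le : ∀ᵐ s ∂(volume.restrict I), |pw s| ≤ ω (|s|) := by
    have hall : ∀ᵐ s ∂(volume.restrict I), ∀ j, |pair j s - ℓ j| ≤ ω (|s|) := ae_all_iff.2 hkey
    filter_upwards [hall, hae] with s hs1 hs2
    have h1 : Tendsto (fun k => pair (ns k) s - ℓ (ns k)) atTop (𝓝 (pw s - 0)) := by
      have h3 : Tendsto (fun k => pair (ns k) s - pw s) atTop (𝓝 0) := hs2
      have h4 : Tendsto (fun k => pair (ns k) s) atTop (𝓝 (pw s)) := by
        have := h3.add_const (pw s)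
        simpa using this
      exact h4.sub (hℓ0.comp hns.tendsto_atTop)
    rw [sub_zero] at h1
    exact le_of_tendsto' h1.abs fun k => hs1 (ns k)
  -- ## the choice of `s₀`
  obtain ⟨d, hd, hdω⟩ := exists_modulus_le hA hB hε
  set s₀ : ℝ := -min d (ρ ^ 2 / 2) with hs₀
  have hs₀neg : s₀ < 0 := by rw [hs₀, neg_lt_zero]; exact lt_min hd (by positivity)
  have hs₀I : Ioo s₀ 0 ⊆ I := by
    refine Ioo_subset_Ioo ?_ le_rfl
    rw [hs₀, neg_le_neg_iff]
    have := min_le_right d (ρ ^ 2 / 2)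
    nlinarith
  refine ⟨s₀, hs₀neg, ?_⟩
  filter_upwards [ae_restrict_of_ae_restrict_of_subset hs₀I hpw_le, ae_restrict_mem measurableSet_Ioo] with s hs hsI'
  refine hs.trans (hdω _ (abs_nonneg s) ?_)
  rw [abs_of_neg hsI'.2]
  have := min_le_left d (ρ ^ 2 / 2)
  linarith [hsI'.1]

/-! ### The uniform pairing modulus from scale-invariant `A` and `D` bounds at the point -/

/-- **A modulus of continuity of the pairings of the rescaled velocities, uniform in the scale,
from the scale-invariant bounds `A(r; z₀) ≤ K`, `D(r; z₀) ≤ K`, `0 < r ≤ 1/2`** (Temam 1977/79,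
Ch. III §3 (3.40)–(3.43); the tree's `NSCylinder.exists_fullMeasure_pairing_modulus`) — the
hypothesis `hmodulus` of `top_vanishing_of_modulus_of_apexTrace` for a pair `(v, p)` solving the
system in the sense of distributions in `Q(z₀, 1/2)`: for a test field `φ` with
`tsupport φ ⊆ B(0, ρ)`, `ρ ≥ 1`, there are `A, B ≥ 0` such that for every `0 < μ` with `ρ μ ≤ 1/2`
the pairing `s ↦ ∫ ⟪u^μ(s), φ⟫`, `u^μ = μ v(t₀ + μ²·, x₀ + μ·)`, satisfies
`|∫ ⟪u^μ(s), φ⟫ - ∫ ⟪u^μ(s'), φ⟫| ≤ A |s - s'| + B |s - s'|^{1/3}` on a full-measure subset of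
`]-ρ², 0[`. The rescaled pair solves the system in `Q(ρ)` (`IsDistributionalNSSolutionOn.stRescale`);
its sliced `L²` bound on `B(0, ρ)` is `μ⁻¹ ∫_{B(x₀, ρμ)} |v|² ≤ ρ K` and its pressure has
`∫_{Q(ρ)} |p^μ|^{3/2} = ρ² D(ρμ; z₀) ≤ ρ² K`, both uniform in `μ`. [cite: EscauriazaSereginSverak2003, §3 (3.13)] [cite: Seregin2014, §6.6 Prop. 6.20] -/
theorem exists_uniform_pairing_modulus_of_bounds
    {p : ℝ → EuclideanSpace ℝ (Fin 3) → ℝ} {z₀ : ℝ × EuclideanSpace ℝ (Fin 3)}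
    (hsol : IsDistributionalNSSolutionOn (parabolicCylinderOpens (1 / 2) z₀) 1 0 v p)
    {K : ℝ≥0} (hA : ∀ r ∈ Ioc (0 : ℝ) (1 / 2), cknAEss r z₀ v ≤ K)
    (hD : ∀ r ∈ Ioc (0 : ℝ) (1 / 2), cknD r z₀ p ≤ K)
    {φ : EuclideanSpace ℝ (Fin 3) → EuclideanSpace ℝ (Fin 3)} (hφ : ContDiff ℝ (⊤ : ℕ∞) φ)
    (hφc : HasCompactSupport φ) {ρ : ℝ} (hρ1 : 1 ≤ ρ)
    (hφρ : tsupport φ ⊆ ball (0 : EuclideanSpace ℝ (Fin 3)) ρ) :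
    ∃ A B : ℝ, 0 ≤ A ∧ 0 ≤ B ∧ ∀ μ : ℝ, 0 < μ → ρ * μ ≤ 1 / 2 →
      ∃ S : Set ℝ, (∀ᵐ s ∂(volume.restrict (Ioo (-ρ ^ 2) 0)), s ∈ S) ∧ ∀ s ∈ S, ∀ s' ∈ S,
        |(∫ y, ⟪(μ • stPull (μ ^ 2) μ z₀.1 z₀.2 v) s y, φ y⟫) -
            ∫ y, ⟪(μ • stPull (μ ^ 2) μ z₀.1 z₀.2 v) s' y, φ y⟫| ≤
          A * |s - s'| + B * |s - s'| ^ (1 / 3 : ℝ) := by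
  have hρ : 0 < ρ := one_pos.trans_le hρ1
  set Ω : Opens (EuclideanSpace ℝ (Fin 3)) := ⟨ball 0 ρ, isOpen_ball⟩ with hΩdef
  have hΩset : ((Ω : Opens (EuclideanSpace ℝ (Fin 3))) : Set (EuclideanSpace ℝ (Fin 3))) = ball 0 ρ := rfl
  have hbΩ : Bornology.IsBounded ((Ω : Opens (EuclideanSpace ℝ (Fin 3))) :
      Set (EuclideanSpace ℝ (Fin 3))) := by rw [hΩset]; exact isBounded_ball
  have hηt : FunctionSpaces.IsTestFunctionOn Ω φ := ⟨hφ, hφc, hφρ⟩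
  obtain ⟨K₀, K₁, K₂, hK₀, hK₁, hK₂⟩ := exists_bounds_of_isTestFunctionOn hηt
  -- ## the uniform constants
  set C : ℝ≥0∞ := ENNReal.ofReal ρ * K with hC
  have hCtop : C ≠ ∞ := ENNReal.mul_ne_top ENNReal.ofReal_ne_top ENNReal.coe_ne_top
  set Cp : ℝ≥0∞ := ENNReal.ofReal ρ ^ 2 * K with hCp
  have hCptop : Cp ≠ ∞ := ENNReal.mul_ne_top (ENNReal.pow_ne_top ENNReal.ofReal_ne_top) ENNReal.coe_ne_top
  set A : ℝ := K₁ * C.toReal + K₂ * ((volume ((Ω : Opens (EuclideanSpace ℝ (Fin 3))) :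
      Set (EuclideanSpace ℝ (Fin 3)))).toReal + C.toReal) with hAdef
  set B : ℝ := 3 * K₁ * (((volume ((Ω : Opens (EuclideanSpace ℝ (Fin 3))) :
      Set (EuclideanSpace ℝ (Fin 3)))) ^ (1 / 2 : ℝ) * Cp) ^ (2 / 3 : ℝ)).toReal with hBdef
  have hK₁0 : 0 ≤ K₁ := (norm_nonneg _).trans (hK₁ 0)
  have hK₂0 : 0 ≤ K₂ := (norm_nonneg _).trans (hK₂ 0)
  refine ⟨A, B, by positivity, by positivity, fun μ hμ hρμ => ?_⟩
  have hμ2 : 0 < μ ^ 2 := pow_pos hμ 2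
  -- ## the rescaled pair on `]-ρ², 0[ × B(0, ρ)`
  set a : ℝ := (0 : ℝ × EuclideanSpace ℝ (Fin 3)).1 - ρ ^ 2 with ha
  set b : ℝ := (0 : ℝ × EuclideanSpace ℝ (Fin 3)).1 with hb
  have hab' : Ioo a b = Ioo (-ρ ^ 2) 0 := by
    rw [ha, hb]; show Ioo ((0 : ℝ) - ρ ^ 2) 0 = Ioo (-ρ ^ 2) 0; rw [zero_sub]
  have hcyl : timeCylinder Ω a b = parabolicCylinderOpens ρ (0 : ℝ × EuclideanSpace ℝ (Fin 3)) := rfl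
  have hcyl_set : Ioo a b ×ˢ ((Ω : Opens (EuclideanSpace ℝ (Fin 3))) : Set (EuclideanSpace ℝ (Fin 3))) =
      parabolicCylinder ρ (0 : ℝ × EuclideanSpace ℝ (Fin 3)) := rfl
  -- the rescaled pair solves the system in `Q(ρ) ⊆ Φ⁻¹(Q(z₀, 1/2))`
  have hsolμ : IsDistributionalNSSolutionOn (timeCylinder Ω a b) 1 0
      (μ • stPull (μ ^ 2) μ z₀.1 z₀.2 v) (μ ^ 2 • stPull (μ ^ 2) μ z₀.1 z₀.2 p) := by
    have h0 := hsol.stRescale hμ hμ (sq μ) z₀.1 z₀.2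
    have hvisc : μ * 1 / μ = 1 := by field_simp
    have hforce : ((μ ^ 2 * μ) • stPull (μ ^ 2) μ z₀.1 z₀.2
        (0 : ℝ → EuclideanSpace ℝ (Fin 3) → EuclideanSpace ℝ (Fin 3))) = 0 := by
      funext s y; simp [stPull]
    rw [hvisc, hforce] at h0
    rw [hcyl]
    refine h0.of_le ?_
    intro q hq
    rw [mem_stPreimage]
    show stAffine (μ ^ 2) μ z₀.1 z₀.2 q ∈
      ((parabolicCylinderOpens (1 / 2) z₀ : Opens (ℝ × EuclideanSpace ℝ (Fin 3))) :
        Set (ℝ × EuclideanSpace ℝ (Fin 3)))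
    rw [coe_parabolicCylinderOpens]
    have hq' : q ∈ parabolicCylinder (ρ * μ / μ) (0 : ℝ × EuclideanSpace ℝ (Fin 3)) := by
      rw [mul_div_cancel_right₀ ρ hμ.ne']; exact hq
    exact parabolicCylinder_mono (by positivity) hρμ z₀ (zoom_mem_parabolicCylinder hμ z₀ hq')
  -- the sliced `L²` bound, uniformly in `μ`
  have hE : ∀ᵐ t ∂(volume.restrict (Ioo a b)),
      ∫⁻ x in ((Ω : Opens (EuclideanSpace ℝ (Fin 3))) : Set (EuclideanSpace ℝ (Fin 3))),
        ‖(μ • stPull (μ ^ 2) μ z₀.1 z₀.2 v) t x‖ₑ ^ 2 ≤ C := by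
    rw [hab', hΩset]
    have hρμpos : 0 < ρ * μ := by positivity
    -- `∫_{B(x₀, ρμ)} |v(t)|² ≤ (ρμ) K` for a.e. `t ∈ ]t₀ - (ρμ)², t₀[`
    have hAr := hA (ρ * μ) ⟨hρμpos, hρμ⟩
    have h1 := ENNReal.ae_le_essSup
      (fun t : ℝ => (ENNReal.ofReal (ρ * μ))⁻¹ * ∫⁻ x in ball z₀.2 (ρ * μ), ‖v t x‖ₑ ^ 2)
      (μ := volume.restrict (Ioo (z₀.1 - (ρ * μ) ^ 2) z₀.1))
    have hr0 : ENNReal.ofReal (ρ * μ) ≠ 0 := (ENNReal.ofReal_pos.2 hρμpos).ne'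
    have hslice : ∀ᵐ t ∂(volume.restrict (Ioo (z₀.1 + μ ^ 2 * (-ρ ^ 2)) (z₀.1 + μ ^ 2 * 0))),
        ∫⁻ x in ball z₀.2 (ρ * μ), ‖v t x‖ₑ ^ 2 ≤ ENNReal.ofReal (ρ * μ) * K := by
      have e : Ioo (z₀.1 + μ ^ 2 * (-ρ ^ 2)) (z₀.1 + μ ^ 2 * 0) = Ioo (z₀.1 - (ρ * μ) ^ 2) z₀.1 := by
        congr 1 <;> ring
      rw [e]
      filter_upwards [h1] with t ht
      have h2 := ht.trans hAr
      calc ∫⁻ x in ball z₀.2 (ρ * μ), ‖v t x‖ₑ ^ 2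
          = ENNReal.ofReal (ρ * μ) * ((ENNReal.ofReal (ρ * μ))⁻¹ *
              ∫⁻ x in ball z₀.2 (ρ * μ), ‖v t x‖ₑ ^ 2) := by
            rw [← mul_assoc, ENNReal.mul_inv_cancel hr0 ENNReal.ofReal_ne_top, one_mul]
        _ ≤ ENNReal.ofReal (ρ * μ) * K := by gcongr
    have h2 := ae_sliced_setLIntegral_ball_stRescale hμ2 hμ z₀.1 z₀.2 z₀.2 (ρ * μ) (-ρ ^ 2) 0
      (fun t x => ‖v t x‖ₑ ^ 2) hslice
    rw [finrank_euclideanSpace_fin, sub_self, smul_zero, mul_div_cancel_right₀ ρ hμ.ne'] at h2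
    filter_upwards [h2] with s hs
    have e : ∀ y : EuclideanSpace ℝ (Fin 3), ‖(μ • stPull (μ ^ 2) μ z₀.1 z₀.2 v) s y‖ₑ ^ 2 =
        ‖μ‖ₑ ^ 2 * ‖v (z₀.1 + μ ^ 2 * s) (z₀.2 + μ • y)‖ₑ ^ 2 := by
      intro y
      rw [smul_stPull_apply, enorm_smul, mul_pow]
    simp only [e]
    rw [lintegral_const_mul' _ _ (by simp)]
    calc ‖μ‖ₑ ^ 2 * ∫⁻ y in ball (0 : EuclideanSpace ℝ (Fin 3)) ρ,
          ‖v (z₀.1 + μ ^ 2 * s) (z₀.2 + μ • y)‖ₑ ^ 2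
        ≤ ‖μ‖ₑ ^ 2 * (ENNReal.ofReal (μ ^ 3)⁻¹ * (ENNReal.ofReal (ρ * μ) * K)) :=
          mul_le_mul' le_rfl hs
      _ = C := by
          rw [hC, Real.enorm_eq_ofReal hμ.le, ← ENNReal.ofReal_pow hμ.le, ← mul_assoc, ← mul_assoc,
            ← ENNReal.ofReal_mul (by positivity), ← ENNReal.ofReal_mul (by positivity)]
          congr 1
          rw [ENNReal.ofReal_eq_ofReal_iff (by positivity) hρ.le]
          field_simp
  -- the pressure bound, uniformly in `μ`
  have hP : ∫⁻ z in Ioo a b ×ˢ ((Ω : Opens (EuclideanSpace ℝ (Fin 3))) : Set (EuclideanSpace ℝ (Fin 3))),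
      ‖(μ ^ 2 • stPull (μ ^ 2) μ z₀.1 z₀.2 p) z.1 z.2‖ₑ ^ (3 / 2 : ℝ) ≤ Cp := by
    rw [hcyl_set]
    have e : ∫⁻ z in parabolicCylinder ρ (0 : ℝ × EuclideanSpace ℝ (Fin 3)),
        ‖(μ ^ 2 • stPull (μ ^ 2) μ z₀.1 z₀.2 p) z.1 z.2‖ₑ ^ (3 / 2 : ℝ) =
        ENNReal.ofReal ρ ^ 2 * cknD (ρ * μ) z₀ p := lintegral_pressure_zoom_radius hμ hρ z₀ p
    rw [e, hCp]
    exact mul_le_mul' le_rfl (hD _ ⟨by positivity, hρμ⟩)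
  -- ## the modulus
  obtain ⟨S, hS, hmod⟩ := NSCylinder.exists_fullMeasure_pairing_modulus hsolμ hbΩ hCtop hCptop hE hP
    hηt hK₁ hK₂
  refine ⟨S, by rw [← hab']; exact hS, fun s hs s' hs' => ?_⟩
  have h1 := hmod s hs s' hs'
  rw [hΩset, ← integral_inner_eq_setIntegral_of_tsupport hφρ,
    ← integral_inner_eq_setIntegral_of_tsupport hφρ] at h1
  exact h1

end Top

end Literature.Analysis.FluidPDE

end

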